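import Summits.CriticalPhenomena.CardyFormulaZ2.Theorems.CardyComplexConeParafermionToSLESixFamiliesFlipRLDict
import Summits.CriticalPhenomena.CardyFormulaZ2.Theorems.CardyComplexConeParafermionToSLESixFamiliesFlipRLOnceTwice
import HarnessLib

/-!
# Return law, file 3: the line's visit quantities on a once/twice pair (values)
(line `flip-involution-return-law` of crux `CardyComplexCone.ParafermionToSLESixFamilies`, stmt-CriticalPhenomena-11389;
third helper file of the stub `stub_returnLaw`)

Combining the visit structure of a once/twice pair (`onceTwice_visits`, file 1) with the dictionary
(`visit_dictionary`, file 2): on a once/twice pair `(ω₁, ω₂)` at the edge `z = cTgt d` (admissible data,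
`z` with no endpoint on the arc `B`, the loop of the partner turning by `4σ`), with `Φ = phase ((π/2) C)`
the first-arrival phase (`C = turnCount i₁`) and `σ = turnSign d` the turn of the once-path at `z`:

* passage sums: `Φ·phase (σπ/4)` (once) and `Φ·phase (−σπ/4) + Φ·phase (σπ)·phase (−σπ/4)` (twice);
* first phases: `Φ` and `Φ`; visit counts: `1` and `2`; first positions `i₁ + 1` on both paths, where the
  line's turn sign is `σ`, resp. `−σ`;
* in-minus-out sums: `Φ − Φ·phase (σπ/2)` (once) and
  `(Φ − Φ·phase (−σπ/2)) + (Φ·phase (σπ) − Φ·phase (σπ/2))` (twice)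

(registered sub-goal `onceTwice_values`). In words: the return arrives antiparallel (winding `+σπ`,
i.e. `−τ₁π` for the first turn `τ₁ = −σ` of the twice-path) and leaves by the forced turn `τ₂ = τ₁`.
-/

noncomputable section

namespace Summit.CriticalPhenomena.CardyFormulaZ2.Cruxes.ParafermionToSLESixFamilies.FlipInvolutionReturnLaw

open MeasureTheory Filter Set Metric
open scoped BigOperators
open Literature.Probability Literature.Probability.LatticeModels Literature.Probability.Percolation

/-- Congruence of `phase` along an equality of real arguments. -/
theorem phase_congr {x y : ℝ} (h : x = y) : phase x = phase y := by rw [h]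

/-- **Values of the line's visit quantities on a once/twice pair** (registered sub-goal `onceTwice_values`
of stmt-CriticalPhenomena-11389, line `flip-involution-return-law`). Admissible data `E`; two configurations
`ω₁`, `ω₂` whose completions agree off `z = cTgt d` and differ at `z`, all faces at both endpoints of `z`
inner and no endpoint of `z` on the arc `B`; `d = orb i₁` a dart of the path of `ω₁` (start corner
`startCorner hE`, exit time `exitTime hE ω₁`) whose partner is not; `Q` the minimal period of the partner's
cycle under `ω₁`, turning by `4 · turnSign d`. Then with `W = (π/2) · turnCount i₁` and `σ = turnSign d`
(in `ω₁`), writing `γᵢ = medialExploration E ωᵢ`: the spin-`1/3` passage sums at `z` are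
`phase W · phase (σπ/4)` and `phase W · phase (−σπ/4) + phase W · phase (σπ) · phase (−σπ/4)`; the first
phases are both `phase W`; the counts of `z` are `1` and `2`; the first positions of `z` are `i₁ + 1` on
both, with the line's turn signs `σ` and `−σ` there; the in-minus-out sums are
`phase W − phase W · phase (σπ/2)` and `(phase W − phase W · phase (−σπ/2)) + (phase W · phase (σπ) −
phase W · phase (σπ/2))`. -/
theorem onceTwice_values : ∀ (E : DiscreteDobrushin) (hE : E.IsZdAdmissible) (ω₁ ω₂ : BondConfig (Site 2)) (d : Site 2 × Fin 4) (i₁ Q : ℕ), (∀ e', e' ≠ cTgt d → (e' ∈ E.bcBondConfig ω₂ ↔ e' ∈ E.bcBondConfig ω₁)) → ¬ (cTgt d ∈ E.bcBondConfig ω₂ ↔ cTgt d ∈ E.bcBondConfig ω₁) → (∀ j, E.IsInnerFace (faceAt d.1 j)) → (∀ j, E.IsInnerFace (faceAt (d.1 + cornerUnit (d.2 + 1)) j)) → (∀ x ∈ cTgt d, x ∉ E.zdArcB) → cornerOrbit (E.bcBondConfig ω₁) (DiscreteDobrushin.startCorner hE) i₁ = d → i₁ < DiscreteDobrushin.exitTime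 hE ω₁ → (∀ i < DiscreteDobrushin.exitTime hE ω₁, cornerOrbit (E.bcBondConfig ω₁) (DiscreteDobrushin.startCorner hE) i ≠ cornerPartner d) → 0 < Q → cornerOrbit (E.bcBondConfig ω₁) (cornerPartner d) Q = cornerPartner d → (∀ s, 0 < s → s < Q → cornerOrbit (E.bcBondConfig ω₁) (cornerPartner d) s ≠ cornerPartner d) → ∑ m ∈ Finset.range Q, LatticeModels.turnSign (E.bcBondConfig ω₁) (cornerOrbit (E.bcBondConfig ω₁) (cornerPartner d) m) = 4 * LatticeModels.turnSign (E.bcBondConfig ω₁) d → (MedialPath.passageSum (medialExploration E ω₁) E.δ (1 / 3) (cTgt d) = phase (Real.pi / 2 * (turnCount (E.bcBondConfig ω₁) (DiscreteDobrushin.startCorner hE) i₁ : ℝ)) * phase (Real.pi / 4 * (LatticeModels.turnSign (E.bcBondConfig ω₁) d : ℝ)) ∧ MedialPath.passageSum (medialExploration E ω₂) E.δ (1 / 3) (cTgt d) = phase (Real.pi / 2 * (turnCount (E.bcBondConfig ω₁) (DiscreteDobrushin.startCorner hE) i₁ : ℝ)) * phase (-(Real.pi / 4 * (LatticeModels.turnSign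 (E.bcBondConfig ω₁) d : ℝ))) + phase (Real.pi / 2 * (turnCount (E.bcBondConfig ω₁) (DiscreteDobrushin.startCorner hE) i₁ : ℝ)) * phase (Real.pi * (LatticeModels.turnSign (E.bcBondConfig ω₁) d : ℝ)) * phase (-(Real.pi / 4 * (LatticeModels.turnSign (E.bcBondConfig ω₁) d : ℝ)))) ∧ (firstPhase (medialExploration E ω₁) E.δ (cTgt d) = phase (Real.pi / 2 * (turnCount (E.bcBondConfig ω₁) (DiscreteDobrushin.startCorner hE) i₁ : ℝ)) ∧ firstPhase (medialExploration E ω₂) E.δ (cTgt d) = phase (Real.pi / 2 * (turnCount (E.bcBondConfig ω₁) (DiscreteDobrushin.startCorner hE) i₁ : ℝ))) ∧ ((medialExploration E ω₁).count (cTgt d) = 1 ∧ (medialExploration E ω₂).count (cTgt d) = 2) ∧ ((medialExploration E ω₁).idxOf (cTgt d) = i₁ + 1 ∧ (medialExploration E ω₂).idxOf (cTgt d) = i₁ + 1 ∧ FlipInvolutionReturnLaw.turnSign (medialExploration E ω₁) E.δ (i₁ + 1) = (LatticeModels.turnSign (E.bcBondConfig ω₁) d : ℝ) ∧ FlipInvolutionReturnLaw.turnSign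 (medialExploration E ω₂) E.δ (i₁ + 1) = -(LatticeModels.turnSign (E.bcBondConfig ω₁) d : ℝ)) ∧ (inOutSum (medialExploration E ω₁) E.δ (cTgt d) = phase (Real.pi / 2 * (turnCount (E.bcBondConfig ω₁) (DiscreteDobrushin.startCorner hE) i₁ : ℝ)) - phase (Real.pi / 2 * (turnCount (E.bcBondConfig ω₁) (DiscreteDobrushin.startCorner hE) i₁ : ℝ)) * phase (Real.pi / 2 * (LatticeModels.turnSign (E.bcBondConfig ω₁) d : ℝ)) ∧ inOutSum (medialExploration E ω₂) E.δ (cTgt d) = (phase (Real.pi / 2 * (turnCount (E.bcBondConfig ω₁) (DiscreteDobrushin.startCorner hE) i₁ : ℝ)) - phase (Real.pi / 2 * (turnCount (E.bcBondConfig ω₁) (DiscreteDobrushin.startCorner hE) i₁ : ℝ)) * phase (-(Real.pi / 2 * (LatticeModels.turnSign (E.bcBondConfig ω₁) d : ℝ)))) + (phase (Real.pi / 2 * (turnCount (E.bcBondConfig ω₁) (DiscreteDobrushin.startCorner hE) i₁ : ℝ)) * phase (Real.pi * (LatticeModels.turnSign (E.bcBondConfig ω₁) d : ℝ)) - phase (Real.pi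 / 2 * (turnCount (E.bcBondConfig ω₁) (DiscreteDobrushin.startCorner hE) i₁ : ℝ)) * phase (Real.pi / 2 * (LatticeModels.turnSign (E.bcBondConfig ω₁) d : ℝ)))) := by
  intro E hE ω₁ ω₂ d i₁ Q hagree hdiff hx hy hB hi₁ hi₁N h₂ hQ0 hQ hQmin hT
  classical
  have hc₀ := DiscreteDobrushin.isStartCorner_startCorner hE
  -- the visit structure of the pair
  obtain ⟨hN₂, hi₁1, hV₁, hV₂, horb₂i₁, horb₂Q, hC₁, hC₂, hs₂, hs₂'⟩ :=
    onceTwice_visits E hE ω₁ ω₂ (DiscreteDobrushin.startCorner hE) d (DiscreteDobrushin.exitTime hE ω₁)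
      (DiscreteDobrushin.exitTime hE ω₂) i₁ Q hc₀ hagree hdiff hx hy
      (DiscreteDobrushin.not_isInnerFace_exitTime hE ω₁) (fun k hk => DiscreteDobrushin.isInnerFace_of_lt_exitTime hE ω₁ hk)
      (DiscreteDobrushin.not_isInnerFace_exitTime hE ω₂) (fun k hk => DiscreteDobrushin.isInnerFace_of_lt_exitTime hE ω₂ hk)
      hi₁ hi₁N h₂ hQ0 hQ hQmin hT
  -- the two visit sets
  have hVset₁ : (Finset.range (DiscreteDobrushin.exitTime hE ω₁)).filter (fun j =>
      cornerOrbit (E.bcBondConfig ω₁) (DiscreteDobrushin.startCorner hE) j = d ∨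
        cornerOrbit (E.bcBondConfig ω₁) (DiscreteDobrushin.startCorner hE) j = cornerPartner d) = {i₁} := by
    ext j
    simp only [Finset.mem_filter, Finset.mem_range, Finset.mem_singleton]
    constructor
    · rintro ⟨hj, h⟩; exact (hV₁ j hj).1 h
    · rintro rfl; exact ⟨hi₁N, Or.inl hi₁⟩
  have hVset₂ : (Finset.range (DiscreteDobrushin.exitTime hE ω₂)).filter (fun j =>
      cornerOrbit (E.bcBondConfig ω₂) (DiscreteDobrushin.startCorner hE) j = d ∨
        cornerOrbit (E.bcBondConfig ω₂) (DiscreteDobrushin.startCorner hE) j = cornerPartner d) = {i₁, i₁ + Q} := by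
    ext j
    simp only [Finset.mem_filter, Finset.mem_range, Finset.mem_insert, Finset.mem_singleton]
    constructor
    · rintro ⟨hj, h⟩; exact (hV₂ j hj).1 h
    · rintro (rfl | rfl)
      · exact ⟨by omega, Or.inl horb₂i₁⟩
      · exact ⟨by omega, Or.inr horb₂Q⟩
  have hne : i₁ ≠ i₁ + Q := by omega
  -- the dictionaries of the two configurations at `p := d`
  obtain ⟨hPS₁, hcount₁, hIO₁, -, hfirst₁⟩ := visit_dictionary E hE ω₁ d hB
  obtain ⟨hPS₂, hcount₂, hIO₂, -, hfirst₂⟩ := visit_dictionary E hE ω₂ d hB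
  rw [hVset₁] at hPS₁ hcount₁ hIO₁ hfirst₁
  rw [hVset₂] at hPS₂ hcount₂ hIO₂ hfirst₂
  obtain ⟨hF₁, hidx₁, hτ₁⟩ := hfirst₁ i₁ (Finset.mem_singleton_self _) (fun i' hi' => by
    rw [Finset.mem_singleton] at hi'; omega)
  obtain ⟨hF₂, hidx₂, hτ₂⟩ := hfirst₂ i₁ (Finset.mem_insert_self _ _) (fun i' hi' => by
    rw [Finset.mem_insert, Finset.mem_singleton] at hi'; omega)
  -- turn signs of the two paths at the arrivals
  have hs₂i₁ : LatticeModels.turnSign (E.bcBondConfig ω₂) (cornerOrbit (E.bcBondConfig ω₂) (DiscreteDobrushin.startCorner hE) i₁) =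
      -LatticeModels.turnSign (E.bcBondConfig ω₁) d := by rw [horb₂i₁]; exact hs₂
  have hs₂Q : LatticeModels.turnSign (E.bcBondConfig ω₂) (cornerOrbit (E.bcBondConfig ω₂) (DiscreteDobrushin.startCorner hE) (i₁ + Q)) =
      -LatticeModels.turnSign (E.bcBondConfig ω₁) d := by rw [horb₂Q]; exact hs₂'
  have hs₁i₁ : LatticeModels.turnSign (E.bcBondConfig ω₁) (cornerOrbit (E.bcBondConfig ω₁) (DiscreteDobrushin.startCorner hE) i₁) =
      LatticeModels.turnSign (E.bcBondConfig ω₁) d := by rw [hi₁]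
  refine ⟨⟨?_, ?_⟩, ⟨hF₁, ?_⟩, ⟨?_, ?_⟩, ⟨hidx₁, hidx₂, ?_, ?_⟩, ⟨?_, ?_⟩⟩
  · -- passage sum, once
    rw [hPS₁, Finset.sum_singleton, hs₁i₁, phase_mul]
  · -- passage sum, twice
    rw [hPS₂, Finset.sum_pair hne, hC₁, hs₂i₁, hC₂, hs₂Q, phase_mul, phase_mul, phase_mul]
    congr 1
    · refine phase_congr ?_
      push_cast; ring
    · refine phase_congr ?_
      push_cast; ring
  · -- first phase, twice
    rw [hF₂, hC₁]
  · rw [hcount₁, Finset.card_singleton]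
  · rw [hcount₂, Finset.card_pair hne]
  · rw [hτ₁, hs₁i₁]
  · rw [hτ₂, hs₂i₁]; push_cast; ring
  · -- in-minus-out, once
    rw [hIO₁, Finset.sum_singleton, hs₁i₁, phase_mul]
    have : (Real.pi / 2 * ((turnCount (E.bcBondConfig ω₁) (DiscreteDobrushin.startCorner hE) i₁ +
        LatticeModels.turnSign (E.bcBondConfig ω₁) d : ℤ) : ℝ)) =
        Real.pi / 2 * (turnCount (E.bcBondConfig ω₁) (DiscreteDobrushin.startCorner hE) i₁ : ℝ) +
          Real.pi / 2 * (LatticeModels.turnSign (E.bcBondConfig ω₁) d : ℝ) := by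
      push_cast; ring
    rw [this]
  · -- in-minus-out, twice
    rw [hIO₂, Finset.sum_pair hne, hC₁, hs₂i₁, hC₂, hs₂Q, phase_mul, phase_mul, phase_mul]
    have e1 : (Real.pi / 2 * ((turnCount (E.bcBondConfig ω₁) (DiscreteDobrushin.startCorner hE) i₁ +
        -LatticeModels.turnSign (E.bcBondConfig ω₁) d : ℤ) : ℝ)) =
        Real.pi / 2 * (turnCount (E.bcBondConfig ω₁) (DiscreteDobrushin.startCorner hE) i₁ : ℝ) +
          -(Real.pi / 2 * (LatticeModels.turnSign (E.bcBondConfig ω₁) d : ℝ)) := by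
      push_cast; ring
    have e2 : (Real.pi / 2 * ((turnCount (E.bcBondConfig ω₁) (DiscreteDobrushin.startCorner hE) i₁ +
        2 * LatticeModels.turnSign (E.bcBondConfig ω₁) d : ℤ) : ℝ)) =
        Real.pi / 2 * (turnCount (E.bcBondConfig ω₁) (DiscreteDobrushin.startCorner hE) i₁ : ℝ) +
          Real.pi * (LatticeModels.turnSign (E.bcBondConfig ω₁) d : ℝ) := by
      push_cast; ring
    have e3 : (Real.pi / 2 * ((turnCount (E.bcBondConfig ω₁) (DiscreteDobrushin.startCorner hE) i₁ +
        2 * LatticeModels.turnSign (E.bcBondConfig ω₁) d + -LatticeModels.turnSign (E.bcBondConfig ω₁) d : ℤ) : ℝ)) =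
        Real.pi / 2 * (turnCount (E.bcBondConfig ω₁) (DiscreteDobrushin.startCorner hE) i₁ : ℝ) +
          Real.pi / 2 * (LatticeModels.turnSign (E.bcBondConfig ω₁) d : ℝ) := by
      push_cast; ring
    rw [e1, e2, e3]

end Summit.CriticalPhenomena.CardyFormulaZ2.Cruxes.ParafermionToSLESixFamilies.FlipInvolutionReturnLaw

end
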